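import Summits.NavierStokesRegularity.NavierStokesRegularity.Theorems.ExtremiserTransienceNearExtremalTransienceExtremiserLiouvilleConstantSpeedEnergyFluxJet
import Summits.NavierStokesRegularity.NavierStokesRegularity.Theorems.ExtremiserTransienceNearExtremalTransienceExtremiserLiouvilleConstantSpeedBlowDownStokeslet
import HarnessLib

/-!
# Crux `ExtremiserTransience.NearExtremalTransience` (stmt-NavierStokesRegularity-21883), line `extremiser_liouville`,
# stub K1b — DOSSIER (g5): K1b ⟸ «no flat-or-jet residue object obeying the STOKESLET LAW of its multiplier»

`--supports stmt-NavierStokesRegularity-21883` (helper).  Author: prover seat `ns-el-k1b` (g5).  The g5 contribution to the dossier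
chain `…ConstantSpeedDossier` (g2) / `…ConstantSpeedMultiplierDossier` (g3) / `…ConstantSpeedTailDossier` (g4): ONE theorem packaging
what this generation proved about the K1b residue.

`stub_noAnalyticExtremal_of_noStokesletObject`: the registered stub K1b (conclusion VERBATIM) follows from the non-existence of a
quadruple `(w, c, M, μ)` where `w` is real analytic, `C^∞`, divergence free, `‖Dw‖` bounded, `D¹w, D²w ∈ L²`, `‖w‖ ≡ M = ‖c‖`,
`w → c` at infinity, `M√Z√W > 0`, `κ⋆M√Z√W = |S|` (g2's residue data), `μ` is a finite measure with `μ(ℝ³) ≤ κ⋆²ZW` and the multiplier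
equation `S·J₁(φ) − κ⋆²M²(W a₁(φ) + Z c₁(φ)) = ∫⟪w, φ⟫dμ` on solenoidal test fields (g3), AND
  (S) **the STOKESLET LAW** (`…ConstantSpeedBlowDownStokeslet`): for every constant `c'` and every solenoidal `Ψ ∈ C_c^∞`,
      `κ⋆²M²W · R⁻²∫⟪w x − c', (ΔΨ)(R⁻¹x)⟫dx → ⟪Ψ(0), ∫ w dμ⟫` as `R → ∞`;
  (F/J) **the FLAT-OR-JET ALTERNATIVE** (`…ConstantSpeedEnergyFluxJet`): either some slab `{|⟪x,c⟫|/‖c‖ ≤ T}` has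
      `∫‖w − c‖² = ∞`, or all slabs are square integrable and the window energies `∫ H′(⟪x,c⟫/‖c‖ − s)‖w − c‖² dx` equal one
      constant `E₀ > 0` for every `s`.
So the K1b target for the next seat (record `Lines/extremiser_liouville_k1b_jet.md` §6): show (S) ∧ (F/J) is inconsistent — for the jet
via the Stokes–Liouville identification of the (horizontal, `L²_loc`-bounded: `…SlabEnergySandwich`, `…JetAxialPairing`) blow-down limits,
which forces `∫ w dμ = 0` and vanishing blow-downs, plus an annular compactness estimate; for the flat case separately.

WHAT THIS IS NOT: K1b is NOT proved; nothing here proves NS regularity. [folklore]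
-/

noncomputable section

open Set Filter Topology MeasureTheory Metric Function
open scoped ENNReal NNReal Topology InnerProductSpace RealInnerProductSpace ContDiff Laplacian
open Literature.Analysis.FluidPDE Literature.Analysis

namespace Summit.NavierStokesRegularity.NavierStokesRegularity.Theorems

-- the problem directory repeats the summit name (`NavierStokesRegularity/NavierStokesRegularity`)
set_option linter.dupNamespace false

namespace ExtremiserLiouville

open DepletionLadder.KStar DepletionLadder.KStar.HalfSpace

/-- **DOSSIER (g5).**  K1b follows from the non-existence of a flat-or-jet residue object `(w, c, M)` carrying a KKT multiplier
measure `μ` that obeys the Stokeslet law (all listed properties are THEOREMS about any K1b residue: g2's data, g3's multiplier,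
g5's energy-flux dichotomy and blow-down pairing law). [folklore] -/
theorem stub_noAnalyticExtremal_of_noStokesletObject
    (hres : ∀ (w : E3 → E3) (c : E3) (M : ℝ) (μ : Measure E3),
      AnalyticOnNhd ℝ w Set.univ → ContDiff ℝ (⊤ : ℕ∞) w → VectorCalculus.IsDivFree w →
      (∃ B : ℝ, ∀ x, ‖fderiv ℝ w x‖ ≤ B) → (∫⁻ x, ‖iteratedFDeriv ℝ 1 w x‖ₑ ^ 2 < ⊤) → (∫⁻ x, ‖iteratedFDeriv ℝ 2 w x‖ₑ ^ 2 < ⊤) →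
      (∀ x, ‖w x‖ = M) → ‖c‖ = M → Tendsto (fun x => w x - c) (cocompact E3) (𝓝 0) →
      0 < M * Real.sqrt (Zen w) * Real.sqrt (Wpa w) → kStar * M * Real.sqrt (Zen w) * Real.sqrt (Wpa w) = |Jst w| →
      -- g3's multiplier
      IsFiniteMeasure μ → μ univ ≤ ENNReal.ofReal (kStar ^ 2 * Zen w * Wpa w) →
      (∀ φ : E3 → E3, ContDiff ℝ ∞ φ → HasCompactSupport φ → VectorCalculus.IsDivFree φ →
        Jst w * J1 w φ - kStar ^ 2 * M ^ 2 * (Wpa w * A1 w φ + Zen w * C1 w φ) = ∫ x, ⟪w x, φ x⟫_ℝ ∂μ) →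
      -- (S) the Stokeslet law
      (∀ (c' : E3) (Ψ : E3 → E3), ContDiff ℝ ∞ Ψ → HasCompactSupport Ψ → VectorCalculus.IsDivFree Ψ →
        Tendsto (fun R : ℝ => kStar ^ 2 * M ^ 2 * Wpa w * (R⁻¹ * R⁻¹ * ∫ x, ⟪w x - c', (Δ Ψ) (R⁻¹ • x)⟫_ℝ))
          atTop (𝓝 ⟪Ψ 0, ∫ x, w x ∂μ⟫_ℝ)) →
      -- (F/J) the flat-or-jet alternative is excluded
      ¬ ((∃ T : ℝ, 0 < T ∧ ¬ Integrable (fun x => {x : E3 | |⟪x, c⟫_ℝ| / ‖c‖ ≤ T}.indicator (fun x => ‖w x - c‖ ^ 2) x) volume) ∨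
         ((∀ T : ℝ, 0 < T → Integrable (fun x => {x : E3 | |⟪x, c⟫_ℝ| / ‖c‖ ≤ T}.indicator (fun x => ‖w x - c‖ ^ 2) x) volume) ∧
           ∃ E₀ : ℝ, 0 < E₀ ∧ ∀ s : ℝ, (∫ x, deriv Real.smoothTransition (⟪x, c⟫_ℝ / ‖c‖ - s) * ‖w x - c‖ ^ 2) = E₀))) :
    ¬ ∃ (w : EuclideanSpace ℝ (Fin 3) → EuclideanSpace ℝ (Fin 3)), AnalyticOnNhd ℝ w Set.univ ∧ (ContDiff ℝ (⊤ : ℕ∞) w ∧ Literature.Analysis.FluidPDE.VectorCalculus.IsDivFree w ∧ (∃ B : ℝ, ∀ x, ‖fderiv ℝ w x‖ ≤ B) ∧ (∫⁻ x, ‖iteratedFDeriv ℝ 1 w x‖ₑ ^ 2 < ⊤) ∧ (∫⁻ x, ‖iteratedFDeriv ℝ 2 w x‖ₑ ^ 2 < ⊤) ∧ ∃ M : ℝ, (∀ x, ‖w x‖ ≤ M) ∧ 0 < M * Real.sqrt (∫ x, ‖Literature.Analysis.FluidPDE.curl w x‖ ^ 2) * Real.sqrt (∫ x, Literature.Analysis.FluidPDE.frobeniusNormSq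 (fderiv ℝ (Literature.Analysis.FluidPDE.curl w) x)) ∧ (sInf {κ : ℝ | (∀ (v : EuclideanSpace ℝ (Fin 3) → EuclideanSpace ℝ (Fin 3)) (M B : ℝ), ContDiff ℝ (⊤ : ℕ∞) v → Literature.Analysis.FluidPDE.VectorCalculus.IsDivFree v → (∀ x, ‖v x‖ ≤ M) → (∀ x, ‖fderiv ℝ v x‖ ≤ B) → (∫⁻ x, ‖iteratedFDeriv ℝ 0 v x‖ₑ ^ 2 < ⊤) → (∫⁻ x, ‖iteratedFDeriv ℝ 1 v x‖ₑ ^ 2 < ⊤) → (∫⁻ x, ‖iteratedFDeriv ℝ 2 v x‖ₑ ^ 2 < ⊤) → |∫ x, ⟪Literature.Analysis.FluidPDE.curl v x, fderiv ℝ v x (Literature.Analysis.FluidPDE.curl v x)⟫_ℝ| ≤ κ * M * Real.sqrt (∫ x, ‖Literature.Analysis.FluidPDE.curl v x‖ ^ 2) * Real.sqrt (∫ x, Literature.Analysis.FluidPDE.frobeniusNormSq (fderiv ℝ (Literature.Analysis.FluidPDE.curl v) x)))}) * M * Real.sqrt (∫ x, ‖Literature.Analysis.FluidPDE.curl w x‖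 ^ 2) * Real.sqrt (∫ x, Literature.Analysis.FluidPDE.frobeniusNormSq (fderiv ℝ (Literature.Analysis.FluidPDE.curl w) x)) ≤ |∫ x, ⟪Literature.Analysis.FluidPDE.curl w x, fderiv ℝ w x (Literature.Analysis.FluidPDE.curl w x)⟫_ℝ|) := by
  refine stub_noAnalyticExtremal_of_noJetObject fun w c M han hcd hdiv hB h1 h2 hM hcM hfar hpos heq => ?_
  -- the residue data in the `HalfSpace` vocabulary (`Jst`, `Zen`, `Wpa`, `kStar` are the same integrals / infimum)
  have hpos' : 0 < M * Real.sqrt (Zen w) * Real.sqrt (Wpa w) := hpos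
  have heq' : kStar * M * Real.sqrt (Zen w) * Real.sqrt (Wpa w) = |Jst w| := heq
  have hMpos : 0 < M := by
    have hM0 : 0 ≤ M := (norm_nonneg _).trans (hM 0).le
    rcases hM0.lt_or_eq with h | h
    · exact h
    · rw [← h, zero_mul, zero_mul] at hpos; exact absurd hpos (lt_irrefl 0)
  obtain ⟨B, hB'⟩ := hB
  -- g3's multiplier measure with g5's Stokeslet law
  obtain ⟨μ, hfin, hmass, hμ, hstokes⟩ := residue_blowDown_stokeslet hcd hdiv hMpos hM hB' h1 h2 heq'.symm
  exact hres w c M μ han hcd hdiv ⟨B, hB'⟩ h1 h2 hM hcM hfar hpos' heq' hfin hmass hμ hstokes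

end ExtremiserLiouville

end Summit.NavierStokesRegularity.NavierStokesRegularity.Theorems

end
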